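import Literature.AlgebraicGeometry.Resolution.RidgeNormalisedBasis
import Literature.AlgebraicGeometry.Resolution.RidgeInvariantAlgebra
import Literature.AlgebraicGeometry.Resolution.PrincipalRidgeHassePPow
import Literature.AlgebraicGeometry.Resolution.DiffStableAdjoin
import HarnessLib

/-!
# Giraud's Lemme 1.6, second and third clauses: normalised generators lie in the algebra of invariants of the
# ridge (`F_i ∈ U`), and `U = K[D_A F_i : |A| < deg F_i]`

Topic: `Literature/AlgebraicGeometry/Resolution`. Sequel of `RidgeNormalisedBasis.lean` (normalised bases,
`𝔉(I) = ⟨D_A g : |A| < d_g⟩`) and `RidgeInvariantAlgebra.lean` (`ridgeAlgebra p I` = Giraud's algebra of invariants: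
`f ∈ U ⟺ f(X + v) = f(X)` for all points `v` of the ridge functor, `I` homogeneous).

> **Giraud 1975, Lemme 1.6 (p.204).** "si `F_1, …, F_m` sont des générateurs homogènes de `I` et si [ils sont
> normalisés], alors **`F_i ∈ U` pour `1 ≤ i ≤ m`**, `U` est l'algèbre engendrée par les `D_A F_i`, `1 ≤ i ≤ m`,
> `|A| < deg F_i`, et enfin `F = Spec(S/U_+ S)`."
> **Berthomieu–Hivert–Mourtada 2010, proof of Cor. 2.12.** "Now, the particular case `A = 0` gives that the `f_i`'s
> are elements of `U`, so `I = (I ∩ U) S`."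

PROVED here (any field `K` of exponential characteristic `p`, `I` homogeneous):

* **`shift_map_eq_of_forall_hasseDeriv_mem_ridgeIdeal`** — a form `g` of degree `d` all of whose lower Hasse–Schmidt
  derivatives `D_A g`, `|A| < d`, lie in `𝔉(I)` is fixed by the translation by every point of the ridge:
  `g(X + v) = g(X)` for `v ∈ F(k')` (Taylor: `coeff_A g(X + v) = (D_A g)(v)`, and `F = V(𝔉)`);
* **`mem_ridgeAlgebra_of_forall_hasseDeriv_mem_ridgeIdeal`** — hence `g ∈ U = ridgeAlgebra p I`;
* **`mem_ridgeAlgebra_of_isNormalisedBasis`** — Giraud's second clause: the members of a normalised basis of `I ≠ S`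
  lie in `U`; **`reducedGen_mem_ridgeAlgebra`** — in particular every reduced Gröbner generator `x^M − NF(x^M)` of a
  homogeneous ideal lies in the algebra of invariants of its ridge; `hasseDeriv_mem_ridgeAlgebra_of_isNormalisedBasis`
  (so do all their Hasse–Schmidt derivatives, `U` being Hasse–Schmidt stable).

* **`ridgeAlgebra_eq_adjoin_hasseCoefficients`** — Giraud's third clause: `U = K[D_A g : g ∈ G, |A| < d_g]` for a
  normalised basis `G` of `I ≠ S` (`⊇`: the derivatives lie in the Hasse–Schmidt-stable `U`; `⊆`: `K[D_A g]` is graded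
  and Hasse–Schmidt stable (composition law `hasseDeriv_hasseDeriv`), hence triangularly presented by additive `σ'`
  with `(σ') = ⟨D_A g⟩ = 𝔉`, so it is the algebra of invariants of `V(𝔉) = F`, which contains `U`);
  **`ridgeAlgebra_eq_adjoin_hasseCoefficients_reducedGens`** — unconditionally for homogeneous `I ≠ S`: `U` is
  generated by the lower Hasse–Schmidt derivatives of the reduced Gröbner basis (BHM Cor. 2.12's route to computing
  the ridge algebra).

Written for the cell res-hironaka (W4.6 rung (iv) support, seat res-L1-s46-pv-7 gen 4). AI-written; AI review is
weaker than expert review.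

## References

* J. Giraud, *Contact maximal en caractéristique positive*, Ann. Sci. ÉNS (4) 8 (1975) 201–234, Lemme 1.6 p.204. [Giraud1975]
* J. Berthomieu, P. Hivert, H. Mourtada, *Computing Hironaka's invariants: ridge and directrix*, Contemp. Math. 521
  (2010) 9–20, Prop. 2.10, Cor. 2.12 (proof). [BerthomieuHivertMourtada2010]
-/

noncomputable section

open MvPolynomial
open scoped MonomialOrder
open Literature.RingTheory.MvPolynomial
open Literature.RingTheory.MvPolynomial.BuchbergerCriterion
open Literature.RingTheory.MvPolynomial.IdealNormalForm

namespace Literature.AlgebraicGeometry.Resolution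

universe u

variable {K : Type u} [Field K] {n : ℕ} {p : ℕ} {I : Ideal (MvPolynomial (Fin n) K)}

/-- **A form whose lower Hasse–Schmidt derivatives lie in `𝔉` is fixed by every translation of the ridge**:
if `g` is homogeneous of degree `d` and `D_A g ∈ 𝔉(I)` for `|A| < d`, then `g(X + v) = g(X)` for every point `v` of
Giraud's ridge functor `F(k')` (the lower Taylor coefficients `(D_A g)(v)` vanish as `F = V(𝔉)`; the top ones are
the coefficients of `g`). [cite: Giraud1975, Lemme 1.6 p.204] -/
theorem shift_map_eq_of_forall_hasseDeriv_mem_ridgeIdeal {g : MvPolynomial (Fin n) K} {d : ℕ} (hg : g.IsHomogeneous d)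
    (h : ∀ A : Fin n →₀ ℕ, A.degree < d → hasseDeriv K A g ∈ ridgeIdeal I)
    {k' : Type u} [CommRing k'] [Algebra K k'] {v : Fin n → k'} (hv : v ∈ ridge k' I) :
    shift v (MvPolynomial.map (algebraMap K k') g) = MvPolynomial.map (algebraMap K k') g := by
  classical
  ext A
  rw [coeff_shift_map, coeff_map]
  rcases lt_trichotomy A.degree d with hlt | heq | hgt
  · rw [mem_ridge_iff_forall_ridgeIdeal.mp hv _ (h A hlt), hg.coeff_eq_zero hlt.ne, map_zero]
  · rw [hasseDeriv_eq_C_coeff_of_degree_eq hg heq, aeval_C]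
  · rw [hasseDeriv_eq_zero_of_lt_degree hg hgt, map_zero, hg.coeff_eq_zero hgt.ne', map_zero]

variable [ExpChar K p]

/-- **Such a form lies in the algebra of invariants `U = ridgeAlgebra p I` of the ridge** (`I` homogeneous;
`RidgeInvariantAlgebra.mem_ridgeAlgebra_iff_forall_shift_eq`). [cite: Giraud1975, Lemme 1.6 p.204] -/
theorem mem_ridgeAlgebra_of_forall_hasseDeriv_mem_ridgeIdeal (hI : ∀ f ∈ I, ∀ e : ℕ, homogeneousComponent e f ∈ I)
    {g : MvPolynomial (Fin n) K} {d : ℕ} (hg : g.IsHomogeneous d)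
    (h : ∀ A : Fin n →₀ ℕ, A.degree < d → hasseDeriv K A g ∈ ridgeIdeal I) : g ∈ ridgeAlgebra p I :=
  (mem_ridgeAlgebra_iff_forall_shift_eq hI g).mpr fun _ _ _ _ hv =>
    shift_map_eq_of_forall_hasseDeriv_mem_ridgeIdeal hg h hv

variable {m : MonomialOrder (Fin n)} {G : Set (MvPolynomial (Fin n) K)} {d : MvPolynomial (Fin n) K → ℕ}

/-- **Giraud's Lemme 1.6, second clause: the members of a normalised basis lie in `U`** ("alors `F_i ∈ U` pour
`1 ≤ i ≤ m`"; BHM: "the particular case `A = 0` gives that the `f_i`'s are elements of `U`").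
[cite: Giraud1975, Lemme 1.6 p.204] -/
theorem mem_ridgeAlgebra_of_isNormalisedBasis (hI : ∀ f ∈ I, ∀ e : ℕ, homogeneousComponent e f ∈ I) (hI' : I ≠ ⊤)
    (hGB : IsNormalisedBasis m I G d) {g : MvPolynomial (Fin n) K} (hg : g ∈ G) : g ∈ ridgeAlgebra p I :=
  mem_ridgeAlgebra_of_forall_hasseDeriv_mem_ridgeIdeal hI (hGB.2.1 g hg) fun _ hA =>
    hasseDeriv_mem_ridgeIdeal_of_isNormalisedBasis hGB hI' hg hA

/-- **Every reduced Gröbner generator `x^M − NF(x^M)` of a homogeneous ideal `I ≠ S` lies in the algebra of invariants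
of its ridge** (the reduced Gröbner basis is normalised, `isNormalisedBasis_reducedGens`).
[cite: BerthomieuHivertMourtada2010, Cor. 2.12 (proof)] -/
theorem reducedGen_mem_ridgeAlgebra (hI : ∀ f ∈ I, ∀ e : ℕ, homogeneousComponent e f ∈ I) (hI' : I ≠ ⊤)
    {M : Fin n →₀ ℕ} (hM : IsMinLead m I M) : reducedGen m I M ∈ ridgeAlgebra p I :=
  mem_ridgeAlgebra_of_isNormalisedBasis hI hI' (isNormalisedBasis_reducedGens hI) ⟨M, hM, rfl⟩

/-- **All Hasse–Schmidt derivatives of a normalised basis lie in `U`** (`U` is Hasse–Schmidt stable,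
`isDiffStable_ridgeAlgebra`; BHM Prop. 2.10: "`D^X_A G ∈ I ∩ k[θ]`" — here the membership in `k[θ] = U`).
[cite: BerthomieuHivertMourtada2010, Prop. 2.10] -/
theorem hasseDeriv_mem_ridgeAlgebra_of_isNormalisedBasis (hI : ∀ f ∈ I, ∀ e : ℕ, homogeneousComponent e f ∈ I)
    (hI' : I ≠ ⊤) (hGB : IsNormalisedBasis m I G d) {g : MvPolynomial (Fin n) K} (hg : g ∈ G) (A : Fin n →₀ ℕ) :
    hasseDeriv K A g ∈ ridgeAlgebra p I :=
  isDiffStable_ridgeAlgebra p I g (mem_ridgeAlgebra_of_isNormalisedBasis hI hI' hGB hg) A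

/-- **`K[D_A g : g ∈ G, |A| < d_g] ⊆ U`** for a normalised basis `G` (one inclusion of Giraud's third clause
`U = K[D_A F_i]`). [cite: Giraud1975, Lemme 1.6 p.204] -/
theorem adjoin_hasseCoefficients_le_ridgeAlgebra (hI : ∀ f ∈ I, ∀ e : ℕ, homogeneousComponent e f ∈ I)
    (hI' : I ≠ ⊤) (hGB : IsNormalisedBasis m I G d) :
    Algebra.adjoin K (⋃ g ∈ G, hasseCoefficients (d g) g) ≤ ridgeAlgebra p I := by
  refine Algebra.adjoin_le ?_
  intro h hh
  obtain ⟨g, hg, hh⟩ := Set.mem_iUnion₂.mp hh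
  obtain ⟨A, -, rfl⟩ := hh
  exact hasseDeriv_mem_ridgeAlgebra_of_isNormalisedBasis hI hI' hGB hg A

/-! ## Giraud's third clause: `U = K[D_A F_i : |A| < deg F_i]` -/

section ThirdClause

open Literature.AlgebraicGeometry.Hironaka2017.EdgeAlgebra

omit [ExpChar K p] in
/-- The lower Hasse–Schmidt derivatives of forms are forms of positive degree, hence constant-free.
[cite: EGAIV4, Thm. 16.11.2 (16.11.2.1)] -/
private theorem constantCoeff_eq_zero_of_mem_hasseCoefficients (hG : ∀ g ∈ G, g.IsHomogeneous (d g))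
    {h : MvPolynomial (Fin n) K} (hh : h ∈ ⋃ g ∈ G, hasseCoefficients (d g) g) : constantCoeff h = 0 := by
  classical
  obtain ⟨g, hg, hh⟩ := Set.mem_iUnion₂.mp hh
  obtain ⟨A, hA, rfl⟩ := hh
  rw [constantCoeff_hasseDeriv]
  exact (hG g hg).coeff_eq_zero hA.ne

omit [ExpChar K p] in
/-- `K[D_A g : |A| < d_g]` is a GRADED subalgebra (generated by forms). [cite: Giraud1975, Lemme 1.6 p.204] -/
theorem isGradedSubalgebra_adjoin_hasseCoefficients (hG : ∀ g ∈ G, g.IsHomogeneous (d g)) :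
    IsGradedSubalgebra (Algebra.adjoin K (⋃ g ∈ G, hasseCoefficients (d g) g)) := by
  classical
  refine IsGradedSubalgebra.adjoin fun h hh => ?_
  obtain ⟨g, hg, hh⟩ := Set.mem_iUnion₂.mp hh
  obtain ⟨A, -, rfl⟩ := hh
  exact ⟨_, isHomogeneous_hasseDeriv_of_isHomogeneous (hG g hg) A⟩

omit [ExpChar K p] in
/-- `K[D_A g : |A| < d_g]` is HASSE–SCHMIDT STABLE (composition law `D_β D_A = binom · D_{A+β}`; the top derivatives
are constants, the higher ones vanish). [cite: Giraud1975, Lemme 1.6 p.204] -/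
theorem isDiffStable_adjoin_hasseCoefficients (hG : ∀ g ∈ G, g.IsHomogeneous (d g)) :
    IsDiffStable (Algebra.adjoin K (⋃ g ∈ G, hasseCoefficients (d g) g)) := by
  classical
  refine IsDiffStable.adjoin fun h hh β => ?_
  obtain ⟨g, hg, hh⟩ := Set.mem_iUnion₂.mp hh
  obtain ⟨A, hA, rfl⟩ := hh
  rw [hasseDeriv_hasseDeriv]
  refine Subalgebra.mul_mem _ (Subalgebra.natCast_mem _ _) ?_
  rcases lt_trichotomy (A + β).degree (d g) with hlt | heq | hgt
  · exact Algebra.subset_adjoin (Set.mem_biUnion hg ⟨A + β, hlt, rfl⟩)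
  · rw [hasseDeriv_eq_C_coeff_of_degree_eq (hG g hg) heq, ← MvPolynomial.algebraMap_eq]
    exact Subalgebra.algebraMap_mem _ _
  · rw [hasseDeriv_eq_zero_of_lt_degree (hG g hg) hgt]
    exact Subalgebra.zero_mem _

omit [ExpChar K p] in
/-- A constant-free element of `K[H]`, `H` constant-free, lies in `⟨H⟩`. [folklore] -/
private theorem mem_span_of_mem_adjoin_of_constantCoeff {H : Set (MvPolynomial (Fin n) K)}
    (hH : ∀ h ∈ H, constantCoeff h = 0) {b : MvPolynomial (Fin n) K} (hb : b ∈ Algebra.adjoin K H)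
    (hb0 : constantCoeff b = 0) : b ∈ Ideal.span H := by
  suffices h : b - C (constantCoeff b) ∈ Ideal.span H by rwa [hb0, C_0, sub_zero] at h
  clear hb0
  induction hb using Algebra.adjoin_induction with
  | mem x hx =>
    rw [hH x hx, C_0, sub_zero]
    exact Ideal.subset_span hx
  | algebraMap c => rw [MvPolynomial.algebraMap_eq, constantCoeff_C, sub_self]; exact Ideal.zero_mem _
  | add x y _ _ hx hy =>
    have : x + y - C (constantCoeff (x + y)) = (x - C (constantCoeff x)) + (y - C (constantCoeff y)) := by
      rw [map_add, map_add]; ring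
    rw [this]; exact Ideal.add_mem _ hx hy
  | mul x y _ _ hx hy =>
    have : x * y - C (constantCoeff (x * y)) =
        x * (y - C (constantCoeff y)) + C (constantCoeff y) * (x - C (constantCoeff x)) := by
      rw [map_mul, map_mul]; ring
    rw [this]
    exact Ideal.add_mem _ (Ideal.mul_mem_left _ _ hy) (Ideal.mul_mem_left _ _ hx)

/-- **Giraud's Lemme 1.6, third clause: `U = K[D_A g : g ∈ G, |A| < d_g]`** — the algebra of invariants of the ridge
is generated by the lower Hasse–Schmidt derivatives of any normalised basis of the homogeneous ideal `I ≠ S`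
("`U` est l'algèbre engendrée par les `D_A F_i`, `1 ≤ i ≤ m`, `|A| < deg F_i`").
[cite: Giraud1975, Lemme 1.6 p.204] [cite: BerthomieuHivertMourtada2010, Cor. 2.12] -/
theorem ridgeAlgebra_eq_adjoin_hasseCoefficients (hI : ∀ f ∈ I, ∀ e : ℕ, homogeneousComponent e f ∈ I)
    (hI' : I ≠ ⊤) (hGB : IsNormalisedBasis m I G d) :
    ridgeAlgebra p I = Algebra.adjoin K (⋃ g ∈ G, hasseCoefficients (d g) g) := by
  classical
  refine le_antisymm ?_ (adjoin_hasseCoefficients_le_ridgeAlgebra hI hI' hGB)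
  set H : Set (MvPolynomial (Fin n) K) := ⋃ g ∈ G, hasseCoefficients (d g) g with hH
  set U' := Algebra.adjoin K H with hU'
  -- `U' = K[σ']`, `σ'` triangular additive, `(σ') = ⟨H⟩ = 𝔉`
  obtain ⟨P⟩ := nonempty_triangularPresentation p U' (isGradedSubalgebra_adjoin_hasseCoefficients hGB.2.1)
    (isDiffStable_adjoin_hasseCoefficients hGB.2.1)
  have hp1 : ∀ e : ℕ, 1 ≤ p ^ e := fun e => Nat.one_le_pow _ _ (expChar_pos K p)
  have h𝔉 : ridgeIdeal I = Ideal.span H := ridgeIdeal_eq_span_hasseCoefficients_of_isNormalisedBasis hGB hI'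
  -- every `h ∈ H` lies in the ideal `(σ')` (constant-free element of `K[σ'] = U'`)
  have hHσ : ∀ h ∈ H, h ∈ Ideal.span (Set.range P.gen) := fun h hh =>
    mem_span_of_mem_adjoin_of_constantCoeff
      (by
        rintro _ ⟨j, rfl⟩
        rw [TriangularPresentation.gen, map_sum]
        refine Finset.sum_eq_zero fun k _ => ?_
        rw [map_mul, map_pow, constantCoeff_X, zero_pow (by have := hp1 (P.expo j); omega), mul_zero])
      (by rw [show Algebra.adjoin K (Set.range P.gen) = U' from P.eq_adjoin.symm]; exact Algebra.subset_adjoin hh)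
      (constantCoeff_eq_zero_of_mem_hasseCoefficients hGB.2.1 hh)
  -- an invariant of `F` is an invariant of `V(σ')`: a zero of all `σ'_j` kills `⟨H⟩ = 𝔉`, i.e. lies in `F`
  intro f hf
  show f ∈ U'
  rw [mem_iff_forall_shift_eq P f]
  intro k' _ _ v hv
  have hvσ : ∀ g ∈ Ideal.span (Set.range P.gen), aeval v g = 0 := fun g hg => by
    refine Submodule.span_induction (p := fun g _ => aeval v g = 0) ?_ (map_zero _)
      (fun x y _ _ hx hy => by rw [map_add, hx, hy, add_zero])
      (fun a x _ hx => by rw [smul_eq_mul, map_mul, hx, mul_zero]) hg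
    rintro _ ⟨j, rfl⟩
    exact hv j
  refine shift_map_eq_of_mem_ridgeAlgebra hf (mem_ridge_iff_forall_ridgeIdeal.mpr fun g hg => ?_)
  rw [h𝔉] at hg
  refine Submodule.span_induction (p := fun g _ => aeval v g = 0) (fun h hh => hvσ h (hHσ h hh)) (map_zero _)
    (fun x y _ _ hx hy => by rw [map_add, hx, hy, add_zero])
    (fun a x _ hx => by rw [smul_eq_mul, map_mul, hx, mul_zero]) hg

/-- **The algebra of invariants of the ridge of a homogeneous ideal `I ≠ S`, computably**: `U = ridgeAlgebra p I` is
generated by the lower Hasse–Schmidt derivatives `D_A γ`, `|A| < |M|`, of the reduced Gröbner generators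
`γ = x^M − NF(x^M)` of `I` (BHM Cor. 2.12: "`U = k[θ_1, …, θ_e]`" computed from a Giraud basis).
[cite: BerthomieuHivertMourtada2010, Cor. 2.12] -/
theorem ridgeAlgebra_eq_adjoin_hasseCoefficients_reducedGens (hI : ∀ f ∈ I, ∀ e : ℕ, homogeneousComponent e f ∈ I)
    (hI' : I ≠ ⊤) :
    ridgeAlgebra p I = Algebra.adjoin K (⋃ g ∈ reducedGens m I, hasseCoefficients (m.degree g).degree g) :=
  ridgeAlgebra_eq_adjoin_hasseCoefficients hI hI' (isNormalisedBasis_reducedGens hI)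

end ThirdClause

end Literature.AlgebraicGeometry.Resolution

end
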